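import HarnessLib
import Summits.Langlands.Langlands.Theses.RepeatedRootSocle
import Literature.NumberTheory.GaloisRepresentations.CyclotomicCharacterFrobeniusProofs
import Literature.NumberTheory.GaloisRepresentations.IntegralGaloisActionProofs
import Literature.NumberTheory.Automorphic.JacquetLanglandsParts

/-!
# EVIDENCE (refuter, not for landing by a refuter): the three typed statements of route
# `RepeatedRootSocle` hold EX FALSO — `UnrefinedWeightTwoLifting` (stmt-Langlands-18086),
# `LimitClassicalUnrefined` (18087), `PadicLimitUnrefined` (18088)

Seat `refuter-rattack-stmt-Langlands-18089-0`, 2026-08-17 (crux-attack on `SectorComplement`).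
The shared hypothesis pair of the three decls,
  `Sympl r := r.IsSymplecticWithMultiplierFun (g ↦ ε(g)⁻¹)`  (multiplier `ε⁻¹`: cohomological, `H¹(A)`)
  `Pure r  := ∀ᶠ v, r unramified at v ∧ ∃ P : ℤ[X], r.HasFrobCharpolyAt v P ∧ (Weil roots)`
            (INTEGRAL arithmetic-Frobenius characteristic polynomial: homological, `V_p(A)`),
is jointly unsatisfiable: `det r(g)² = ε(g)⁻⁴`, so at an arithmetic Frobenius `σ_v` (`v ∤ p`,
`ε(σ_v) = q_v`) `det r(σ_v)² q_v⁴ = 1`, whereas `det r(σ_v) = P(0) ∈ ℤ`; `P(0)² q_v⁴ = 1` is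
impossible in `ℤ` (`q_v ≥ 2`).  Hence each statement is provable by `False.elim` — for the WRONG
reason.  These proofs are attached as item evidence so that the planner RESTATES (minimal repair:
homological multiplier `ε`, i.e. replace `(cyclotomicCharacter ℚ p g)⁻¹` by
`cyclotomicCharacter ℚ p g` in `Sympl`, as route `PhantomRM` does; then `det = ε²`,
`det r(σ_v) = q_v² = P(0)`, consistent with the `P`-ordinary shape `(εα, εβ | β⁻¹, α⁻¹)` and with
Weil roots `|z|² = q_v`); they must NOT be landed as closing the items.

`lean check` rc 0, 0 sorry; axioms propext / Classical.choice / Quot.sound.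
-/

set_option linter.dupNamespace false

noncomputable section

open scoped NumberField MatrixGroups Matrix
open IsDedekindDomain Field Filter
open Literature.NumberTheory.GaloisRepresentations
open Summit.Langlands.Langlands.Theses.RepeatedRootSocle

namespace Summit.Langlands.Langlands.Cruxes.SectorComplement.RattackRRS.Evidence

/-- Core clash: multiplier `ε⁻¹` versus an integral arithmetic-Frobenius characteristic
polynomial at a cofinite set of places (rank 4 over `ℚ`). [folklore] -/
theorem sympl_invCyclotomic_integralFrobCharpoly_false (p : ℕ) [Fact p.Prime]
    (ρ : FramedGaloisRep ℚ (PadicAlgCl p) 4)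
    (hS : ρ.IsSymplecticWithMultiplierFun (fun g => algebraMap ℚ_[p] (PadicAlgCl p)
      ((((GaloisRep.cyclotomicCharacter ℚ p g)⁻¹ : ℤ_[p]ˣ) : ℤ_[p]) : ℚ_[p])))
    (hP : ∀ᶠ v : HeightOneSpectrum (𝓞 ℚ) in cofinite, ∃ P : Polynomial ℤ,
      ρ.HasFrobCharpolyAt v (P.map (Int.castRingHom (PadicAlgCl p)))) : False := by
  classical
  have hfin : {v : HeightOneSpectrum (𝓞 ℚ) | ((p : ℕ) : 𝓞 ℚ) ∈ v.asIdeal}.Finite := by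
    have hne : (Ideal.span {((p : ℕ) : 𝓞 ℚ)} : Ideal (𝓞 ℚ)) ≠ ⊥ := by
      rw [Ne, Ideal.span_singleton_eq_bot]
      exact_mod_cast (Fact.out : p.Prime).ne_zero
    refine (Ideal.finite_factors hne).subset ?_
    intro v hv
    simp only [Set.mem_setOf_eq] at hv ⊢
    rw [Ideal.dvd_span_singleton]
    exact hv
  have hcof : ∀ᶠ v : HeightOneSpectrum (𝓞 ℚ) in cofinite, ((p : ℕ) : 𝓞 ℚ) ∉ v.asIdeal := by
    rw [Filter.eventually_cofinite]
    simpa using hfin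
  haveI := Literature.NumberTheory.Automorphic.infinite_heightOneSpectrum ℚ
  obtain ⟨v, ⟨P, hPv⟩, hv⟩ := (hP.and hcof).exists
  obtain ⟨𝔓, h𝔓⟩ := v.primesAbove_nonempty
  obtain ⟨σ, hσ⟩ := HeightOneSpectrum.exists_isArithFrobAt_of_mem_primesAbove_holds h𝔓
  have hε : ((GaloisRep.cyclotomicCharacter ℚ p σ : ℤ_[p]ˣ) : ℤ_[p]) = (v.residueCard : ℤ_[p]) :=
    GaloisRep.cyclotomicCharacter_apply_of_isArithFrobAt hv h𝔓 hσ
  have hchar : FramedRep.charpoly ρ σ = P.map (Int.castRingHom (PadicAlgCl p)) :=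
    hPv 𝔓 h𝔓 σ hσ
  set M : Matrix (Fin 4) (Fin 4) (PadicAlgCl p) :=
    ((ρ σ : GL (Fin 4) (PadicAlgCl p)) : Matrix (Fin 4) (Fin 4) (PadicAlgCl p)) with hM
  have hdet : M.det = ((P.coeff 0 : ℤ) : PadicAlgCl p) := by
    rw [Matrix.det_eq_sign_charpoly_coeff]
    have hc : M.charpoly = P.map (Int.castRingHom (PadicAlgCl p)) := hchar
    rw [hc, Polynomial.coeff_map, Fintype.card_fin]
    norm_num
  set ν : PadicAlgCl p := algebraMap ℚ_[p] (PadicAlgCl p)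
      ((((GaloisRep.cyclotomicCharacter ℚ p σ)⁻¹ : ℤ_[p]ˣ) : ℤ_[p]) : ℚ_[p]) with hν
  have hνq : ν * (v.residueCard : PadicAlgCl p) = 1 := by
    have h1 : ((((GaloisRep.cyclotomicCharacter ℚ p σ)⁻¹ : ℤ_[p]ˣ) : ℤ_[p]) : ℚ_[p]) *
        (v.residueCard : ℚ_[p]) = 1 := by
      rw [← PadicInt.coe_natCast, ← hε, ← PadicInt.coe_mul, ← Units.val_mul, inv_mul_cancel,
        Units.val_one, PadicInt.coe_one]
    have h2 := congrArg (algebraMap ℚ_[p] (PadicAlgCl p)) h1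
    rwa [map_mul, map_natCast, map_one] at h2
  obtain ⟨J, -, hJunit, hJ⟩ := hS
  have hdet2 : M.det ^ 2 = ν ^ 4 := by
    have h := congrArg Matrix.det (hJ σ)
    rw [Matrix.det_mul, Matrix.det_mul, Matrix.det_transpose, Matrix.det_smul,
      Fintype.card_fin] at h
    have hJ0 : J.det ≠ 0 := hJunit.ne_zero
    have h' : (M.det ^ 2 - ν ^ 4) * J.det = 0 := by
      rw [sub_mul, sq]
      linear_combination h
    rcases mul_eq_zero.mp h' with h'' | h''
    · exact sub_eq_zero.mp h''
    · exact absurd h'' hJ0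
  have hZ : (((P.coeff 0) ^ 2 * (v.residueCard : ℤ) ^ 4 : ℤ) : PadicAlgCl p) = 1 := by
    push_cast
    calc ((P.coeff 0 : ℤ) : PadicAlgCl p) ^ 2 * (v.residueCard : PadicAlgCl p) ^ 4
        = M.det ^ 2 * (v.residueCard : PadicAlgCl p) ^ 4 := by rw [hdet]
      _ = ν ^ 4 * (v.residueCard : PadicAlgCl p) ^ 4 := by rw [hdet2]
      _ = (ν * (v.residueCard : PadicAlgCl p)) ^ 4 := by ring
      _ = 1 := by rw [hνq, one_pow]
  have hZ' : (P.coeff 0) ^ 2 * (v.residueCard : ℤ) ^ 4 = 1 := by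
    exact_mod_cast hZ
  have hdvd : ((v.residueCard : ℤ) ^ 4) ∣ 1 := ⟨(P.coeff 0) ^ 2, by linarith⟩
  have hq1 : ((v.residueCard : ℤ) ^ 4) = 1 := Int.eq_one_of_dvd_one (by positivity) hdvd
  have hq : (v.residueCard : ℤ) = 1 := by
    rcases (pow_eq_one_iff_of_ne_zero (by norm_num : (4 : ℕ) ≠ 0)).mp hq1 with h | h
    · exact h
    · exfalso
      have : (0 : ℤ) ≤ v.residueCard := by positivity
      linarith [h.1]
  have hlt := v.one_lt_residueCard
  omega

/-- Verbatim-hypothesis form: `Sympl r → Pure r → False`. [folklore] -/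
theorem sympl_pure_false (p : ℕ) [Fact p.Prime]
    (r : FramedGaloisRep ℚ (PadicAlgCl p) 4)
    (hS : r.IsSymplecticWithMultiplierFun (fun g => algebraMap ℚ_[p] (PadicAlgCl p)
      ((((GaloisRep.cyclotomicCharacter ℚ p g)⁻¹ : ℤ_[p]ˣ) : ℤ_[p]) : ℚ_[p])))
    (hP : ∀ᶠ v : HeightOneSpectrum (𝓞 ℚ) in Filter.cofinite, r.IsUnramifiedAt v ∧
      ∃ P : Polynomial ℤ, r.HasFrobCharpolyAt v (P.map (Int.castRingHom (PadicAlgCl p))) ∧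
        ∀ z : ℂ, (P.map (Int.castRingHom ℂ)).IsRoot z → ‖z‖ ^ 2 = (v.residueCard : ℝ)) :
    False :=
  sympl_invCyclotomic_integralFrobCharpoly_false p r hS (hP.mono fun _ ⟨_, P, hP, _⟩ => ⟨P, hP⟩)

/-- stmt-Langlands-18086 (target) holds EX FALSO: hypotheses `Sympl ρ₀`, `Pure ρ₀` clash.
Evidence of VACUITY, not a proof to be landed. [folklore] -/
theorem unrefinedWeightTwoLifting_exFalso : UnrefinedWeightTwoLifting := by
  intro p _ _ k _ _ _ _ _ red hcpt ι
  dsimp only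
  intro ρ₀ _ _ hS₀ _ hP₀
  exact (sympl_pure_false p ρ₀ hS₀ hP₀).elim

/-- stmt-Langlands-18087 (crux, the "heart") holds EX FALSO: hypotheses `Sympl ρ`, `Pure ρ`
clash.  Evidence of VACUITY, not a proof to be landed. [folklore] -/
theorem limitClassicalUnrefined_exFalso : LimitClassicalUnrefined := by
  intro p _ _ k _ _ _ _ _ red hcpt ι
  dsimp only
  intro ρ _ hS _ hP
  exact (sympl_pure_false p ρ hS hP).elim

/-- stmt-Langlands-18088 (crux) holds EX FALSO: hypotheses `Sympl ρ₀`, `Pure ρ₀` clash.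
Evidence of VACUITY, not a proof to be landed. [folklore] -/
theorem padicLimitUnrefined_exFalso : PadicLimitUnrefined := by
  intro p _ _ k _ _ _ _ _ red hcpt ι
  dsimp only
  intro ρ₀ _ _ hS₀ _ hP₀
  exact (sympl_pure_false p ρ₀ hS₀ hP₀).elim

/-- Consequently the junction item is the summit: `SectorComplement ↔ Langlands`. [folklore] -/
theorem sectorComplement_iff_langlands : SectorComplement ↔ _root_.Langlands :=
  ⟨fun hC => hC unrefinedWeightTwoLifting_exFalso, fun hL _ => hL⟩

/-- … and the route's deciding theorem degenerates: all four hypotheses of `closes` other than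
`SectorComplement` are provable, and `SectorComplement` is the conclusion itself. [folklore] -/
theorem closes_degenerate : Assembly ∧ PadicLimitUnrefined ∧ LimitClassicalUnrefined ∧
    (SectorComplement ↔ _root_.Langlands) :=
  ⟨fun _ _ hSC => hSC unrefinedWeightTwoLifting_exFalso, padicLimitUnrefined_exFalso,
    limitClassicalUnrefined_exFalso, sectorComplement_iff_langlands⟩

end Summit.Langlands.Langlands.Cruxes.SectorComplement.RattackRRS.Evidence

end
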